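import Mathlib
import Summits.BirchSwinnertonDyer.BirchSwinnertonDyer.Theorems.ManinLocalTwoThreeDegreeCoprimeSixLValue
import Summits.BirchSwinnertonDyer.BirchSwinnertonDyer.Theorems.ManinLocalTwoThreeOddDegreeAtkinLehnerSigns
import Summits.BirchSwinnertonDyer.BirchSwinnertonDyer.Theorems.ManinLocalTwoThreeEvenDegreeOfFrickeSignPlus
import HarnessLib

/-!
# `N = 4p`, `3 ∤ deg φ`: root number `+1`, `w_{4p} f = −f`, `w_p f = f`

Summit `BirchSwinnertonDyer`, sub-problem `BirchSwinnertonDyer`, route `ManinLocalTwoThree`; width seat `bsd-line-manin23-p2`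
(gen 9), `--supports` the crux C2 `ManinOddAtFour` (stmt-BirchSwinnertonDyer-22967).  Sign consequences of
`modularSymbol_zero_ne_zero_of_not_three_dvd` (`3 ∤ deg φ_D ⟹ {∞,0}_f ≠ 0`, every curve, every datum at `N = 4p`):
a newform with `{∞,0}_f ≠ 0` has Fricke sign `−1` (`{∞,0} = 0` when `w_N f = f`), and at `N = 4p` (`λ_2 = −1` always)
this pins `λ_p = +1`.

PROVED here (no `sorry`): `frickeInvolution_eq_neg_of_modularSymbol_zero_ne_zero` (any level),
`atkinLehnerInvolutionAt_p_eq_self_of_frickeInvolution_eq_neg` (`N = 4p`, form level),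
**`rootNumber_eq_one_of_not_three_dvd`**, **`frickeInvolution_eq_neg_of_not_three_dvd`**,
**`atkinLehnerInvolutionAt_p_eq_self_of_not_three_dvd`**.  BSD is not proved by this; Manin's conjecture is not proved by this.
-/

set_option autoImplicit false
set_option linter.dupNamespace false

noncomputable section

open scoped MatrixGroups ModularForm
open CongruenceSubgroup
open Literature.NumberTheory.EllipticCurves Literature.NumberTheory.EllipticCurves.ModularForms

namespace Summit.BirchSwinnertonDyer.BirchSwinnertonDyer.Theorems.ManinLocalTwoThree

/-- **A newform with `{∞,0}_f ≠ 0` has Fricke sign `−1`** (any level): `w_N f = ±f`, and `+` forces `{∞,0}_f = 0`. -/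
theorem frickeInvolution_eq_neg_of_modularSymbol_zero_ne_zero {N : ℕ} [NeZero N] {f : CuspForm (Gamma0 N) 2}
    (hf : IsNewform0 f) (h0 : modularSymbol f 0 ≠ 0) : frickeInvolution N 2 f = -f := by
  have hw := IsNewform0.frickeInvolution_eq_smul_holds hf
  rcases IsNewform0.frickeEigenvalue_eq_one_or_eq_neg_one_holds hf with h1 | h1
  · rw [h1, one_smul] at hw
    exact absurd (modularSymbol_zero_eq_zero_of_frickeInvolution_eq_self hw) h0
  · rw [hw, h1, neg_one_smul]

/-- **`N = 4p`, `w_N f = −f` ⟹ `w_p f = f`** for a newform `f` (`ε_N = λ_2·λ_p` with `λ_2 = −1`). -/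
theorem atkinLehnerInvolutionAt_p_eq_self_of_frickeInvolution_eq_neg {p : ℕ} [NeZero (4 * p)] (hp : p.Prime)
    (hp2 : p ≠ 2) {f : CuspForm (Gamma0 (4 * p)) 2} (hf : IsNewform0 f) (hF : frickeInvolution (4 * p) 2 f = -f) :
    atkinLehnerInvolutionAt (4 * p) 2 p f = f := by
  obtain ⟨ε, hε, hw⟩ := IsNewform0.exists_atkinLehnerInvolutionAt_eq_smul_holds hf hp (Dvd.intro_left 4 rfl)
  rcases hε with rfl | rfl
  · rw [hw, one_smul]
  · exfalso
    rw [neg_one_smul] at hw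
    have hF' := frickeInvolution_eq_self_of_atkinLehnerInvolutionAt_p_eq_neg hp hp2 hf hw
    rw [hF'] at hF
    -- `f = -f` forces `f = 0`, contradicting `IsNewform0`
    have h2 : (2 : ℂ) • f = 0 := by rw [two_smul]; nth_rw 2 [hF]; exact add_neg_cancel f
    exact hf.ne_zero ((smul_eq_zero.mp h2).resolve_left two_ne_zero)

/-- **`3 ∤ deg φ_D` at `N = 4p` ⟹ root number `+1`** (every curve, every datum). -/
theorem rootNumber_eq_one_of_not_three_dvd {W : WeierstrassCurve ℚ} [W.IsElliptic] {p : ℕ} [NeZero (4 * p)]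
    (hp : p.Prime) (hp2 : p ≠ 2) (D : ModularParametrizationData W (4 * p)) (h3 : ¬ 3 ∣ D.deg) :
    W.rootNumber = 1 :=
  WeierstrassCurve.rootNumber_eq_one_of_entireLFunction_one_ne_zero
    (entireLFunction_one_ne_zero_of_not_three_dvd hp hp2 D h3)

/-- **`3 ∤ deg φ_D` at `N = 4p` ⟹ `w_{4p} f_D = −f_D`.** -/
theorem frickeInvolution_eq_neg_of_not_three_dvd {W : WeierstrassCurve ℚ} [W.IsElliptic] {p : ℕ} [NeZero (4 * p)]
    (hp : p.Prime) (hp2 : p ≠ 2) (D : ModularParametrizationData W (4 * p)) (h3 : ¬ 3 ∣ D.deg) :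
    frickeInvolution (4 * p) 2 D.f = -D.f :=
  frickeInvolution_eq_neg_of_modularSymbol_zero_ne_zero D.isNewformOf.1
    (modularSymbol_zero_ne_zero_of_not_three_dvd hp hp2 D h3)

/-- **`3 ∤ deg φ_D` at `N = 4p` ⟹ `w_p f_D = f_D` (`λ_p = +1`).** -/
theorem atkinLehnerInvolutionAt_p_eq_self_of_not_three_dvd {W : WeierstrassCurve ℚ} [W.IsElliptic] {p : ℕ}
    [NeZero (4 * p)] (hp : p.Prime) (hp2 : p ≠ 2) (D : ModularParametrizationData W (4 * p)) (h3 : ¬ 3 ∣ D.deg) :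
    atkinLehnerInvolutionAt (4 * p) 2 p D.f = D.f :=
  atkinLehnerInvolutionAt_p_eq_self_of_frickeInvolution_eq_neg hp hp2 D.isNewformOf.1
    (frickeInvolution_eq_neg_of_not_three_dvd hp hp2 D h3)

end Summit.BirchSwinnertonDyer.BirchSwinnertonDyer.Theorems.ManinLocalTwoThree

end
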